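import Mathlib.Analysis.InnerProductSpace.Basic
import Mathlib.Analysis.InnerProductSpace.LinearMap
import Mathlib.Analysis.Normed.Operator.LinearIsometry
import Mathlib.Tactic.Linarith
import Mathlib.Tactic.FieldSimp
import Mathlib.Tactic.Ring

/-!
# Profile gauge for the open-chain conductance (ideator 1, generation 2 — TOOL, not a line)

Crux `stmt-AtomisticToContinuum-11749` (`JunctionLocality.ConductanceLowerBound`).

Chain-level statement (equilibrium open chain, both Langevin baths at `T`, `L = A + S` on
`L²(μ_T)`, `Π` = momentum flip, `L* = Π L Π`; `h_x` = site energies, `j_x` = bond currents,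
`w₋ := (p₀² − T) − (p²_{N−1} − T)`):
for EVERY weight profile `c : Fin N → ℝ` with `c₀ = 1`, `c_{N−1} = −1`, putting
`K_c := Σ_x c_x h_x` and `J_c := Σ_x (c_x − c_{x+1}) j_x` (weights summing to `2`), energy balance
`L h_x = j_{x−1} − j_x + (bath terms at x ∈ {0, N−1})` gives the exact coboundary relation
`(−L) K_c = γ w₋ + J_c`, with `⟪J_c, K_c⟫ = 0` (parity) and `⟪(−L)K_c, K_c⟫ = γT Σ_b E[(∂_{p_b}K_c)²] = 2γT²`
(the Dirichlet form sees only the two bath momenta, where `c` is pinned to `±1`).  The abstract lemma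
`gauge_identity` below then yields, with `R = (−L)⁻¹`,
  `⟪J_c, (−L)⁻¹ J_c⟫ = 2γT² − γ² ⟪w₋, (−L)⁻¹ w₋⟫ = 4 T² G_N`   for every admissible `c`
(`G_N = D_N/(N−1)`; `c` linear is Kundu–Dhar–Narayan's `(N−1)T²D_N = ∫₀^∞⟨J_tot J_tot(t)⟩`, `c` a
step at bond `m` is `G_N = T⁻² ∫₀^∞ ⟨j_m(0) j_m(t)⟩_open dt` for ANY bond `m`), and for interior
profiles `d` (`d₀ = d_{N−1} = 0`) `J_d = (−L)K_d` with `S K_d = 0`, so `⟪J_d,(−L)⁻¹J_d⟫ = 0`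
(`interior_free`): interior energy re-weightings are exact coboundaries of bath-invisible functions
and carry no Green–Kubo weight.  USE: every time-domain line (kick-dipole-no-collapse,
late-anticorrelation-budget) may choose the profile; the late-time (boundary) share of the GK
integral that must be controlled is `1 − |W|·G_N/κ` for a window `W` of bonds (heuristic, Fourier
regime): minimal (`O(1/N)`) for the linear profile, one half for the middle-half window, `1 − 1/N`
for a single bond (the truncated `t^{-3/2}` tail).  So the linear profile is already optimal for
no-collapse arguments; single-bond/window forms trade bulk locality for a larger late budget.

Only the Hilbert-space skeleton is proved here (no measure theory): `R` is any linear map standing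
for `(−L)⁻¹` on the relevant vectors, `Π` a linear isometric involution with `Π R Π = Rᵀ`.
-/

open scoped RealInnerProductSpace

namespace Summit.AtomisticToContinuum.FouriersLaw.Cruxes.ConductanceLowerBound.ProfileGauge

variable {V : Type*} [NormedAddCommGroup V] [InnerProductSpace ℝ V]

/-- **Profile gauge identity (abstract core).**  Let `R` be linear (`(−L)⁻¹`), `Π` a linear
isometry with `Π ∘ Π = id` and `Π R Π = Rᵀ` (`⟪Pf (R (Pf x)), y⟫ = ⟪x, R y⟫`, i.e. `L* = Π L Π`).
If `K = R w + R J` (`(−L)K = w + J`), `⟪J, K⟫ = 0` (parity), `Π w = w` (even) and `Π J = −J` (odd),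
then `⟪J, R J⟫ + ⟪w, R w⟫ = ⟪w + J, K⟫` (= the Dirichlet form of `K`, profile-independent in the
chain). -/
theorem gauge_identity (R : V →ₗ[ℝ] V) (Pf : V →ₗᵢ[ℝ] V)
    (hflip : ∀ x, Pf (Pf x) = x) (hrev : ∀ x y, ⟪Pf (R (Pf x)), y⟫ = ⟪x, R y⟫)
    {w J K : V} (hK : K = R w + R J) (hpar : ⟪J, K⟫ = 0) (hw : Pf w = w) (hJ : Pf J = -J) :
    ⟪J, R J⟫ + ⟪w, R w⟫ = ⟪w + J, K⟫ := by
  -- ⟪w, R J⟫ = ⟪Pf (R w), J⟫ = ⟪R w, Pf J⟫ = -⟪R w, J⟫ = -⟪K - R J, J⟫ = ⟪R J, J⟫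
  have h1 : ⟪w, R J⟫ = ⟪Pf (R w), J⟫ := by
    have := hrev w J
    rw [hw] at this
    exact this.symm
  have h2 : ⟪Pf (R w), J⟫ = ⟪R w, Pf J⟫ := by
    have := Pf.inner_map_map (R w) (Pf J)
    rw [hflip] at this
    exact this
  have h3 : ⟪w, R J⟫ = ⟪J, R J⟫ := by
    rw [h1, h2, hJ, inner_neg_right]
    have hRw : R w = K - R J := by rw [hK]; abel
    rw [hRw, inner_sub_left, real_inner_comm J K, hpar, real_inner_comm J (R J)]
    ring
  have h4 : ⟪w + J, K⟫ = ⟪w, K⟫ := by rw [inner_add_left, hpar, add_zero]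
  have h5 : ⟪w, K⟫ = ⟪w, R w⟫ + ⟪w, R J⟫ := by rw [hK, inner_add_right]
  rw [h4, h5, h3]
  ring

/-- **All admissible profiles carry the same Green–Kubo weight.**  Two decompositions
`K = R w + R J`, `K' = R w + R J'` of the SAME even source `w` (same contact observable `γ w₋`)
with the same Dirichlet value `⟪w + J, K⟫ = ⟪w + J', K'⟫` (`= 2γT²` in the chain) have
`⟪J, R J⟫ = ⟪J', R J'⟫` (`= 4T²G_N`). -/
theorem gauge_invariance (R : V →ₗ[ℝ] V) (Pf : V →ₗᵢ[ℝ] V)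
    (hflip : ∀ x, Pf (Pf x) = x) (hrev : ∀ x y, ⟪Pf (R (Pf x)), y⟫ = ⟪x, R y⟫)
    {w J K J' K' : V} (hK : K = R w + R J) (hpar : ⟪J, K⟫ = 0)
    (hK' : K' = R w + R J') (hpar' : ⟪J', K'⟫ = 0)
    (hw : Pf w = w) (hJ : Pf J = -J) (hJ' : Pf J' = -J')
    (hΔ : ⟪w + J, K⟫ = ⟪w + J', K'⟫) :
    ⟪J, R J⟫ = ⟪J', R J'⟫ := by
  have e1 := gauge_identity R Pf hflip hrev hK hpar hw hJ
  have e2 := gauge_identity R Pf hflip hrev hK' hpar' hw hJ'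
  linarith

/-- **Interior re-weightings are free.**  If `K = R J` (no contact source: `d₀ = d_{N−1} = 0`,
`(−L)K_d = J_d`) and `⟪J, K⟫ = 0`, then `⟪J, R J⟫ = 0`. -/
theorem interior_free (R : V →ₗ[ℝ] V) {J K : V} (hK : K = R J) (hpar : ⟪J, K⟫ = 0) :
    ⟪J, R J⟫ = 0 := by
  rw [← hK]; exact hpar

/-- **Conductance form.**  In the chain `w = γ w₋`, `⟪w + J_c, K_c⟫ = 2γT²` and
`S_w := ⟪w₋, R w₋⟫`; the identity reads `⟪J_c, R J_c⟫ = 2γT² − γ² S_w`, and with the contact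
identity `G_N = γ/2 − γ² S_w/(4T²)` (Kundu–Dhar–Narayan corner identity, crux NOTES T1) this is
`⟪J_c, R J_c⟫ = 4 T² G_N`.  Pure arithmetic version: -/
theorem conductance_form {γ T S Q G : ℝ} (hT : T ≠ 0)
    (hQ : Q = 2 * γ * T ^ 2 - γ ^ 2 * S) (hG : G = γ / 2 - γ ^ 2 * S / (4 * T ^ 2)) :
    Q = 4 * T ^ 2 * G := by
  subst hQ; subst hG
  field_simp
  ring

end Summit.AtomisticToContinuum.FouriersLaw.Cruxes.ConductanceLowerBound.ProfileGauge
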